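import Summits.HodgeConjecture.HodgeConjecture.Theorems.SixfoldTableXCensusWeilRow13KWeilAllMembers
import Literature.AlgebraicGeometry.Milne1999.NotCMTypeOfSmallEndomorphismAlgebra
import HarnessLib

/-!
# TABLE X ROW 13 `g6.IV(3,1).kE0`, EVERY MEMBER — the HC corollary keyed by the ladder item `WeilSixfolds`, the isogeny-class
# forms, and the census with the domain datum `¬ IsOfCMType` DISCHARGED (cell `pub-hodgeav-hg6`, req-37 (A) Q2b; eng-3 g3,
# lead g3 2026-08-29T05:59:49Z (a))

HONEST FRAMING. HC, `HC_AV` (stmt-1333), `HC_CM` (stmt-3052) and H2 are NOT proved and do not occur. X2 ∕ X1 stay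
`@[conjecture]` (OURS); `WeilSixfolds` (stmt-HodgeConjecture-2524), R-W6 and Markman₆ (preprint, unrefereed) appear only as
displayed hypotheses of the HC corollaries. KERNEL ONLY: one-line theorems over existing declarations; no definition, no
`sorry`, no named fact; restates nothing.

* §1 `hodgeConjectureFor_row13_kWeil_of_weilSixfolds` (+ `_of_isIsogenous`) — L16's
  `WeilERows.hodgeConjectureFor_weilType_generalE_of_weilSixfolds` in L16b's row vocabulary (hgen ∕ Rosati partner) with the
  group hypothesis `hG` discharged by `hG_of_kWeil_cmField` (p701175): HC for every row-13 member ⟸ the DISPLAYED `WeilSixfolds`.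
* §2 `hodgeConjectureFor_of_isIsogenous_row13_kWeil_of_markman₆_nonsplit` — the isogeny-class form of p701175's
  `hodgeConjectureFor_row13_kWeil_of_markman₆_nonsplit`.
* §3 `census_row13_kWeil'` (+ `_of_isIsogenous`) — p701175's census with `hcm : ¬ IsOfCMType A` DISCHARGED
  (`not_isOfCMType_of_isSimple_of_finrank_endAlgebra_lt`: `A` simple, `dim_ℚ End⁰(A) = 2|ι| ≤ 6 < 12`).
All declarations in the sub-namespace `TableX.WeilLieRows`; typed ≠ proved.
-/

set_option linter.dupNamespace false

noncomputable section

open scoped TensorProduct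
open CategoryTheory
open Literature.AlgebraicGeometry Literature.AlgebraicGeometry.Motives
open Literature.AlgebraicGeometry.Motives.AbelianVariety (IsIsogenous IsSimple)
open Literature.AlgebraicGeometry.Motives.HodgeStructure
open Literature.AlgebraicGeometry.HodgeTheory
open Literature.AlgebraicGeometry.Milne1999
open Literature.AlgebraicGeometry.Deligne1982 (isOfHodgeType_one_one_of_isKaehlerClass_smul)
open Literature.AlgebraicGeometry.VanGeemen1994 (pullbackOne hodgeGroupOne detOnEigenspace hodgeClassSpan)
open Literature.AlgebraicTopology.SingularHomology
open Literature.Barriers.HodgeConjecture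
open Literature.Geometry.Kaehler (HasHardLefschetzProperty)
open Summit.HodgeConjecture.HodgeConjecture.Ring2.ClassTargets
open Summit.HodgeConjecture.HodgeConjecture.Ring2.Motiv (ProdCMCell)
open Summit.HodgeConjecture.HodgeConjecture.Ring2.Atlas (IsQuarticFieldTypeIVFourfold)

namespace Summit.HodgeConjecture.HodgeConjecture.TableX.WeilLieRows

variable (A : AbelianVariety ℂ) (φ : A ⟶ A) (d : ℕ) {h : complexBetti A.X 2}

/-! ## §1 HC for every row-13 member ⟸ the ladder item `WeilSixfolds` -/

/-- **HC for every ROW-13 member ⟸ the ladder item `WeilSixfolds` (stmt-HodgeConjecture-2524, DISPLAYED, not asserted)** —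
L16's `WeilERows.hodgeConjectureFor_weilType_generalE_of_weilSixfolds` in row vocabulary with `hG` discharged by
`hG_of_kWeil_cmField`. HC NOT proved unconditionally. [cite: vanGeemen1994HodgeAV, 2.4 and Thm. 6.12]
[cite: Milne1999LefschetzClasses, Cor. 4.5] [cite: MoonenZarhin1999LowDim, Thm. 0.2 and (2.3)] -/
theorem hodgeConjectureFor_row13_kWeil_of_weilSixfolds
    (hW₆ : Theses.SevenfoldWeilCensus.WeilSixfolds)
    (hW : IsWeilType A φ 3 d) (hS : IsSimple A) (φE φEdag : A ⟶ A)
    (hgen : ∀ ψ : A ⟶ A, pullbackOne A ψ ∈ Algebra.adjoin ℂ {pullbackOne A φE})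
    (hdiag : ⨆ μ : ℂ, Module.End.eigenspace (pullbackOne A φE) μ = ⊤)
    (hQ : IsRationalClass h) (hK : ∃ s : ℝ, 0 < s ∧ IsKaehlerClass A.dim A.X ((s : ℂ) • h))
    (hRos : ∀ x y : complexBetti A.X 1,
      polarizationPairingOne A.X h (A.dim - 1) (pullbackOne A φE x) y =
        polarizationPairingOne A.X h (A.dim - 1) x (pullbackOne A φEdag y))
    (hφQ : ∀ x y, polarizationPairingOne A.X h (A.dim - 1) (pullbackOne A φ x) (pullbackOne A φ y) =
      (d : ℂ) • polarizationPairingOne A.X h (A.dim - 1) x y)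
    {ι : Type} [Fintype ι] [DecidableEq ι] (hι : Fintype.card ι ≤ 3)
    (hE : Module.finrank ℚ A.endAlgebra = 2 * Fintype.card ι)
    (μ : ι → ℂ) (hinj : Function.Injective μ) (hdist : ∀ k k', μ k' ≠ starRingEnd ℂ (μ k))
    (hmult : ∀ k, eigenMultiplicity A φE (μ k) + eigenMultiplicity A φE (starRingEnd ℂ (μ k)) = 2)
    (k₀ : ι) (hk₀ : eigenMultiplicity A φE (μ k₀) ≠ 0 ∧ eigenMultiplicity A φE (starRingEnd ℂ (μ k₀)) ≠ 0)
    (hunb : ∀ k, k ≠ k₀ → eigenMultiplicity A φE (μ k) = 0 ∨ eigenMultiplicity A φE (starRingEnd ℂ (μ k)) = 0)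
    (k₁ k₂ : ι) (hk₁₂ : k₁ ≠ k₂) (hk₁ : k₁ ≠ k₀) (hk₂ : k₂ ≠ k₀)
    (hKW : eigenMultiplicity A φE (μ k₁) + eigenMultiplicity A φE (μ k₂) = 2)
    (hKE : ∀ k, Module.End.eigenspace (((bettiCohomology.map φE.hom.hom.hom 1).hom).baseChange ℂ) (μ k) ≤
      Module.End.eigenspace (((bettiCohomology.map φ.hom.hom.hom 1).hom).baseChange ℂ) (Complex.I * (Real.sqrt d : ℂ)))
    (hKE' : ∀ k, Module.End.eigenspace (((bettiCohomology.map φE.hom.hom.hom 1).hom).baseChange ℂ) (starRingEnd ℂ (μ k)) ≤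
      Module.End.eigenspace (((bettiCohomology.map φ.hom.hom.hom 1).hom).baseChange ℂ) (-(Complex.I * (Real.sqrt d : ℂ)))) :
    HodgeConjectureFor A.dim A.X :=
  have hC := centralizerAlgebra_eq_centralizer_singleton_of_forall_mem_adjoin φE hgen
  WeilERows.hodgeConjectureFor_weilType_generalE_of_weilSixfolds A φ d hW₆ hW φE hC hdiag hQ hK (pullbackOne A φEdag)
    (pullbackOne_mem_centralizer_centralizerAlgebra φEdag) hRos hφQ
    (hG_of_kWeil_cmField hι hW hS φE hE μ hinj hdist hmult k₀ hk₀ hunb k₁ k₂ hk₁₂ hk₁ hk₂ hKW hKE hKE' hQ hK hφQ)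

/-- **… and on the whole isogeny class** (`HodgeConjectureFor.of_isIsogenous`). `WeilSixfolds` displayed; HC NOT proved
unconditionally. [cite: vanGeemen1994HodgeAV, Lemma 3.7 and Thm. 6.12] -/
theorem hodgeConjectureFor_of_isIsogenous_row13_kWeil_of_weilSixfolds {A' : AbelianVariety ℂ}
    (hW₆ : Theses.SevenfoldWeilCensus.WeilSixfolds)
    (hW : IsWeilType A φ 3 d) (hS : IsSimple A) (φE φEdag : A ⟶ A)
    (hgen : ∀ ψ : A ⟶ A, pullbackOne A ψ ∈ Algebra.adjoin ℂ {pullbackOne A φE})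
    (hdiag : ⨆ μ : ℂ, Module.End.eigenspace (pullbackOne A φE) μ = ⊤)
    (hQ : IsRationalClass h) (hK : ∃ s : ℝ, 0 < s ∧ IsKaehlerClass A.dim A.X ((s : ℂ) • h))
    (hRos : ∀ x y : complexBetti A.X 1,
      polarizationPairingOne A.X h (A.dim - 1) (pullbackOne A φE x) y =
        polarizationPairingOne A.X h (A.dim - 1) x (pullbackOne A φEdag y))
    (hφQ : ∀ x y, polarizationPairingOne A.X h (A.dim - 1) (pullbackOne A φ x) (pullbackOne A φ y) =
      (d : ℂ) • polarizationPairingOne A.X h (A.dim - 1) x y)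
    {ι : Type} [Fintype ι] [DecidableEq ι] (hι : Fintype.card ι ≤ 3)
    (hE : Module.finrank ℚ A.endAlgebra = 2 * Fintype.card ι)
    (μ : ι → ℂ) (hinj : Function.Injective μ) (hdist : ∀ k k', μ k' ≠ starRingEnd ℂ (μ k))
    (hmult : ∀ k, eigenMultiplicity A φE (μ k) + eigenMultiplicity A φE (starRingEnd ℂ (μ k)) = 2)
    (k₀ : ι) (hk₀ : eigenMultiplicity A φE (μ k₀) ≠ 0 ∧ eigenMultiplicity A φE (starRingEnd ℂ (μ k₀)) ≠ 0)
    (hunb : ∀ k, k ≠ k₀ → eigenMultiplicity A φE (μ k) = 0 ∨ eigenMultiplicity A φE (starRingEnd ℂ (μ k)) = 0)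
    (k₁ k₂ : ι) (hk₁₂ : k₁ ≠ k₂) (hk₁ : k₁ ≠ k₀) (hk₂ : k₂ ≠ k₀)
    (hKW : eigenMultiplicity A φE (μ k₁) + eigenMultiplicity A φE (μ k₂) = 2)
    (hKE : ∀ k, Module.End.eigenspace (((bettiCohomology.map φE.hom.hom.hom 1).hom).baseChange ℂ) (μ k) ≤
      Module.End.eigenspace (((bettiCohomology.map φ.hom.hom.hom 1).hom).baseChange ℂ) (Complex.I * (Real.sqrt d : ℂ)))
    (hKE' : ∀ k, Module.End.eigenspace (((bettiCohomology.map φE.hom.hom.hom 1).hom).baseChange ℂ) (starRingEnd ℂ (μ k)) ≤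
      Module.End.eigenspace (((bettiCohomology.map φ.hom.hom.hom 1).hom).baseChange ℂ) (-(Complex.I * (Real.sqrt d : ℂ))))
    (hA'A : IsIsogenous A' A) : HodgeConjectureFor A'.dim A'.X :=
  HodgeConjectureFor.of_isIsogenous hA'A
    (hodgeConjectureFor_row13_kWeil_of_weilSixfolds A φ d hW₆ hW hS φE φEdag hgen hdiag hQ hK hRos hφQ hι hE μ hinj hdist
      hmult k₀ hk₀ hunb k₁ k₂ hk₁₂ hk₁ hk₂ hKW hKE hKE')

/-! ## §2 HC ⟸ {Markman₆, R-W6} on the isogeny class -/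

/-- **HC for everything isogenous to a ROW-13 member ⟸ {Markman₆ (preprint, UNREFEREED), R-W6 (OPEN)}, both DISPLAYED.**
HC NOT proved unconditionally. [cite: Markman2025SecantWeil, Thm. 1.5.1 (preprint, unrefereed)]
[claim: Markman2025SurveySecant, status: under-review] [cite: vanGeemen1994HodgeAV, Lemma 3.7 and Thm. 6.12] -/
theorem hodgeConjectureFor_of_isIsogenous_row13_kWeil_of_markman₆_nonsplit {A' : AbelianVariety ℂ}
    (hMark₆ : Markman2025_weilClasses_algebraic_hyperbolicSixfold) (hRW6 : WeilTypeLadder.NonsplitSixfolds)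
    (hW : IsWeilType A φ 3 d) (hS : IsSimple A) (φE φEdag : A ⟶ A)
    (hgen : ∀ ψ : A ⟶ A, pullbackOne A ψ ∈ Algebra.adjoin ℂ {pullbackOne A φE})
    (hdiag : ⨆ μ : ℂ, Module.End.eigenspace (pullbackOne A φE) μ = ⊤)
    (hQ : IsRationalClass h) (hK : ∃ s : ℝ, 0 < s ∧ IsKaehlerClass A.dim A.X ((s : ℂ) • h))
    (hRos : ∀ x y : complexBetti A.X 1,
      polarizationPairingOne A.X h (A.dim - 1) (pullbackOne A φE x) y =
        polarizationPairingOne A.X h (A.dim - 1) x (pullbackOne A φEdag y))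
    (hφQ : ∀ x y, polarizationPairingOne A.X h (A.dim - 1) (pullbackOne A φ x) (pullbackOne A φ y) =
      (d : ℂ) • polarizationPairingOne A.X h (A.dim - 1) x y)
    {ι : Type} [Fintype ι] [DecidableEq ι] (hι : Fintype.card ι ≤ 3)
    (hE : Module.finrank ℚ A.endAlgebra = 2 * Fintype.card ι)
    (μ : ι → ℂ) (hinj : Function.Injective μ) (hdist : ∀ k k', μ k' ≠ starRingEnd ℂ (μ k))
    (hmult : ∀ k, eigenMultiplicity A φE (μ k) + eigenMultiplicity A φE (starRingEnd ℂ (μ k)) = 2)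
    (k₀ : ι) (hk₀ : eigenMultiplicity A φE (μ k₀) ≠ 0 ∧ eigenMultiplicity A φE (starRingEnd ℂ (μ k₀)) ≠ 0)
    (hunb : ∀ k, k ≠ k₀ → eigenMultiplicity A φE (μ k) = 0 ∨ eigenMultiplicity A φE (starRingEnd ℂ (μ k)) = 0)
    (k₁ k₂ : ι) (hk₁₂ : k₁ ≠ k₂) (hk₁ : k₁ ≠ k₀) (hk₂ : k₂ ≠ k₀)
    (hKW : eigenMultiplicity A φE (μ k₁) + eigenMultiplicity A φE (μ k₂) = 2)
    (hKE : ∀ k, Module.End.eigenspace (((bettiCohomology.map φE.hom.hom.hom 1).hom).baseChange ℂ) (μ k) ≤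
      Module.End.eigenspace (((bettiCohomology.map φ.hom.hom.hom 1).hom).baseChange ℂ) (Complex.I * (Real.sqrt d : ℂ)))
    (hKE' : ∀ k, Module.End.eigenspace (((bettiCohomology.map φE.hom.hom.hom 1).hom).baseChange ℂ) (starRingEnd ℂ (μ k)) ≤
      Module.End.eigenspace (((bettiCohomology.map φ.hom.hom.hom 1).hom).baseChange ℂ) (-(Complex.I * (Real.sqrt d : ℂ))))
    (hA'A : IsIsogenous A' A) : HodgeConjectureFor A'.dim A'.X :=
  HodgeConjectureFor.of_isIsogenous hA'A
    (hodgeConjectureFor_row13_kWeil_of_markman₆_nonsplit A φ d hMark₆ hRW6 hW hS φE φEdag hgen hdiag hQ hK hRos hφQ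
      hι hE μ hinj hdist hmult k₀ hk₀ hunb k₁ k₂ hk₁₂ hk₁ hk₂ hKW hKE hKE')

/-! ## §3 The census with the domain datum `¬ IsOfCMType A` discharged -/

/-- **ROW 13, EVERY MEMBER, census with `¬ IsOfCMType A` DISCHARGED**: `A` simple with `dim_ℚ End⁰(A) = 2|ι| ≤ 6 < 12 = 2 dim A`
is not of CM type (`not_isOfCMType_of_isSimple_of_finrank_endAlgebra_lt`); otherwise `census_row13_kWeil` verbatim. HC NOT proved.
[cite: Milne1999, §2 p. 54] [cite: MoonenZarhin1999LowDim, (1.9) and (2.3)] [cite: Milne1999LefschetzClasses, Thm. 3.2 and Cor. 4.5] -/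
theorem census_row13_kWeil' (hW : IsWeilType A φ 3 d) (hS : IsSimple A)
    (φE φEdag : A ⟶ A) (hgen : ∀ ψ : A ⟶ A, pullbackOne A ψ ∈ Algebra.adjoin ℂ {pullbackOne A φE})
    (hdiag : ⨆ μ : ℂ, Module.End.eigenspace (pullbackOne A φE) μ = ⊤)
    (hQ : IsRationalClass h) (hK : ∃ s : ℝ, 0 < s ∧ IsKaehlerClass A.dim A.X ((s : ℂ) • h))
    (hRos : ∀ x y : complexBetti A.X 1,
      polarizationPairingOne A.X h (A.dim - 1) (pullbackOne A φE x) y =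
        polarizationPairingOne A.X h (A.dim - 1) x (pullbackOne A φEdag y))
    (hφQ : ∀ x y, polarizationPairingOne A.X h (A.dim - 1) (pullbackOne A φ x) (pullbackOne A φ y) =
      (d : ℂ) • polarizationPairingOne A.X h (A.dim - 1) x y)
    {ι : Type} [Fintype ι] [DecidableEq ι] (hι : Fintype.card ι ≤ 3)
    (hE : Module.finrank ℚ A.endAlgebra = 2 * Fintype.card ι)
    (μ : ι → ℂ) (hinj : Function.Injective μ) (hdist : ∀ k k', μ k' ≠ starRingEnd ℂ (μ k))
    (hmult : ∀ k, eigenMultiplicity A φE (μ k) + eigenMultiplicity A φE (starRingEnd ℂ (μ k)) = 2)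
    (k₀ : ι) (hk₀ : eigenMultiplicity A φE (μ k₀) ≠ 0 ∧ eigenMultiplicity A φE (starRingEnd ℂ (μ k₀)) ≠ 0)
    (hunb : ∀ k, k ≠ k₀ → eigenMultiplicity A φE (μ k) = 0 ∨ eigenMultiplicity A φE (starRingEnd ℂ (μ k)) = 0)
    (k₁ k₂ : ι) (hk₁₂ : k₁ ≠ k₂) (hk₁ : k₁ ≠ k₀) (hk₂ : k₂ ≠ k₀)
    (hKW : eigenMultiplicity A φE (μ k₁) + eigenMultiplicity A φE (μ k₂) = 2)
    (hKE : ∀ k, Module.End.eigenspace (((bettiCohomology.map φE.hom.hom.hom 1).hom).baseChange ℂ) (μ k) ≤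
      Module.End.eigenspace (((bettiCohomology.map φ.hom.hom.hom 1).hom).baseChange ℂ) (Complex.I * (Real.sqrt d : ℂ)))
    (hKE' : ∀ k, Module.End.eigenspace (((bettiCohomology.map φE.hom.hom.hom 1).hom).baseChange ℂ) (starRingEnd ℂ (μ k)) ≤
      Module.End.eigenspace (((bettiCohomology.map φ.hom.hom.hom 1).hom).baseChange ℂ) (-(Complex.I * (Real.sqrt d : ℂ)))) :
    (A.dim = 6 ∧ ¬ (IsOfCMType A ∨ ProdCMCell IsQuarticFieldTypeIVFourfold (fun Z ↦ Z.dim = 2) A)) ∧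
    (∀ c : complexBetti A.X (2 * 2), IsRationalClass c → IsOfHodgeType A.dim A.X (2 * 2) 2 2 c →
      c ∈ divisorClassesSpan A.X A.dim 2 ⊔ Submodule.span ℂ {w' : complexBetti A.X (2 * 2) |
        ∃ (C : AbelianVariety ℂ) (g : A.X ⟶ C.X) (w : complexBetti C.X (2 * 2)), C.dim < A.dim ∧
          IsRationalClass w ∧ IsOfHodgeType C.dim C.X (2 * 2) 2 2 w ∧ w' = complexBetti.map g (2 * 2) w}) ∧
    (∀ c : complexBetti A.X (2 * 3), IsRationalClass c → IsOfHodgeType A.dim A.X (2 * 3) 3 3 c →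
      c ∈ divisorClassesSpan A.X A.dim 3 ⊔ Submodule.span ℂ {w' : complexBetti A.X (2 * 3) |
          ∃ (a : complexBetti A.X (2 * 2)) (b : complexBetti A.X (2 * 1)),
            IsRationalClass a ∧ IsOfHodgeType A.dim A.X (2 * 2) 2 2 a ∧ IsRationalClass b ∧
            IsOfHodgeType A.dim A.X (2 * 1) 1 1 b ∧ w' = cupProduct (two_mul_add_two_mul 2 1) a b} ⊔
        Submodule.span ℂ {w' : complexBetti A.X (2 * 3) |
          ∃ (C : AbelianVariety ℂ) (g : A.X ⟶ C.X) (w : complexBetti C.X (2 * 3)), C.dim < A.dim ∧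
            IsRationalClass w ∧ IsOfHodgeType C.dim C.X (2 * 3) 3 3 w ∧ w' = complexBetti.map g (2 * 3) w} ⊔
        Submodule.span ℂ {w' : complexBetti A.X (2 * 3) |
          ∃ (B' : AbelianVariety ℂ) (g : A.X ⟶ B'.X) (d : ℕ) (ψ : B' ⟶ B') (w : complexBetti B'.X (2 * 3)),
            B'.dim = 6 ∧ 0 < d ∧ ψ ≫ ψ = -(d • 𝟙 B') ∧ IsRationalClass w ∧
            IsOfHodgeType B'.dim B'.X (2 * 3) 3 3 w ∧ w ∈ weilClassesOf B' ψ 3 d ∧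
            w' = complexBetti.map g (2 * 3) w}) := by
  haveI : HodgeTensorFacts.{0, 0} := hodgeTensorFacts_holds
  exact census_row13_kWeil A φ d hW hS (not_isOfCMType_of_isSimple_of_finrank_endAlgebra_lt hS (by rw [hW.dim_eq]; norm_num)
      (by rw [hE, hW.dim_eq]; omega))
    φE φEdag hgen hdiag hQ hK hRos hφQ hι hE μ hinj hdist hmult k₀ hk₀ hunb k₁ k₂ hk₁₂ hk₁ hk₂ hKW hKE hKE'

/-- **… on the whole isogeny class**, `¬ IsOfCMType A` discharged. [cite: Milne1999, §2 p. 54]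
[cite: vanGeemen1994HodgeAV, Lemma 3.7 and Thm. 6.12] -/
theorem census_row13_kWeil'_of_isIsogenous {A' : AbelianVariety ℂ} (hW : IsWeilType A φ 3 d)
    (hS : IsSimple A)
    (φE φEdag : A ⟶ A) (hgen : ∀ ψ : A ⟶ A, pullbackOne A ψ ∈ Algebra.adjoin ℂ {pullbackOne A φE})
    (hdiag : ⨆ μ : ℂ, Module.End.eigenspace (pullbackOne A φE) μ = ⊤)
    (hQ : IsRationalClass h) (hK : ∃ s : ℝ, 0 < s ∧ IsKaehlerClass A.dim A.X ((s : ℂ) • h))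
    (hRos : ∀ x y : complexBetti A.X 1,
      polarizationPairingOne A.X h (A.dim - 1) (pullbackOne A φE x) y =
        polarizationPairingOne A.X h (A.dim - 1) x (pullbackOne A φEdag y))
    (hφQ : ∀ x y, polarizationPairingOne A.X h (A.dim - 1) (pullbackOne A φ x) (pullbackOne A φ y) =
      (d : ℂ) • polarizationPairingOne A.X h (A.dim - 1) x y)
    {ι : Type} [Fintype ι] [DecidableEq ι] (hι : Fintype.card ι ≤ 3)
    (hE : Module.finrank ℚ A.endAlgebra = 2 * Fintype.card ι)
    (μ : ι → ℂ) (hinj : Function.Injective μ) (hdist : ∀ k k', μ k' ≠ starRingEnd ℂ (μ k))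
    (hmult : ∀ k, eigenMultiplicity A φE (μ k) + eigenMultiplicity A φE (starRingEnd ℂ (μ k)) = 2)
    (k₀ : ι) (hk₀ : eigenMultiplicity A φE (μ k₀) ≠ 0 ∧ eigenMultiplicity A φE (starRingEnd ℂ (μ k₀)) ≠ 0)
    (hunb : ∀ k, k ≠ k₀ → eigenMultiplicity A φE (μ k) = 0 ∨ eigenMultiplicity A φE (starRingEnd ℂ (μ k)) = 0)
    (k₁ k₂ : ι) (hk₁₂ : k₁ ≠ k₂) (hk₁ : k₁ ≠ k₀) (hk₂ : k₂ ≠ k₀)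
    (hKW : eigenMultiplicity A φE (μ k₁) + eigenMultiplicity A φE (μ k₂) = 2)
    (hKE : ∀ k, Module.End.eigenspace (((bettiCohomology.map φE.hom.hom.hom 1).hom).baseChange ℂ) (μ k) ≤
      Module.End.eigenspace (((bettiCohomology.map φ.hom.hom.hom 1).hom).baseChange ℂ) (Complex.I * (Real.sqrt d : ℂ)))
    (hKE' : ∀ k, Module.End.eigenspace (((bettiCohomology.map φE.hom.hom.hom 1).hom).baseChange ℂ) (starRingEnd ℂ (μ k)) ≤
      Module.End.eigenspace (((bettiCohomology.map φ.hom.hom.hom 1).hom).baseChange ℂ) (-(Complex.I * (Real.sqrt d : ℂ))))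
    (hA'A : IsIsogenous A' A) :
    (A'.dim = 6 ∧ ¬ (IsOfCMType A' ∨ ProdCMCell IsQuarticFieldTypeIVFourfold (fun Z ↦ Z.dim = 2) A')) ∧
    (∀ c : complexBetti A'.X (2 * 2), IsRationalClass c → IsOfHodgeType A'.dim A'.X (2 * 2) 2 2 c →
      c ∈ divisorClassesSpan A'.X A'.dim 2 ⊔ Submodule.span ℂ {w' : complexBetti A'.X (2 * 2) |
        ∃ (C : AbelianVariety ℂ) (g : A'.X ⟶ C.X) (w : complexBetti C.X (2 * 2)), C.dim < A'.dim ∧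
          IsRationalClass w ∧ IsOfHodgeType C.dim C.X (2 * 2) 2 2 w ∧ w' = complexBetti.map g (2 * 2) w}) ∧
    (∀ c : complexBetti A'.X (2 * 3), IsRationalClass c → IsOfHodgeType A'.dim A'.X (2 * 3) 3 3 c →
      c ∈ divisorClassesSpan A'.X A'.dim 3 ⊔ Submodule.span ℂ {w' : complexBetti A'.X (2 * 3) |
          ∃ (a : complexBetti A'.X (2 * 2)) (b : complexBetti A'.X (2 * 1)),
            IsRationalClass a ∧ IsOfHodgeType A'.dim A'.X (2 * 2) 2 2 a ∧ IsRationalClass b ∧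
            IsOfHodgeType A'.dim A'.X (2 * 1) 1 1 b ∧ w' = cupProduct (two_mul_add_two_mul 2 1) a b} ⊔
        Submodule.span ℂ {w' : complexBetti A'.X (2 * 3) |
          ∃ (C : AbelianVariety ℂ) (g : A'.X ⟶ C.X) (w : complexBetti C.X (2 * 3)), C.dim < A'.dim ∧
            IsRationalClass w ∧ IsOfHodgeType C.dim C.X (2 * 3) 3 3 w ∧ w' = complexBetti.map g (2 * 3) w} ⊔
        Submodule.span ℂ {w' : complexBetti A'.X (2 * 3) |
          ∃ (B' : AbelianVariety ℂ) (g : A'.X ⟶ B'.X) (d : ℕ) (ψ : B' ⟶ B') (w : complexBetti B'.X (2 * 3)),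
            B'.dim = 6 ∧ 0 < d ∧ ψ ≫ ψ = -(d • 𝟙 B') ∧ IsRationalClass w ∧
            IsOfHodgeType B'.dim B'.X (2 * 3) 3 3 w ∧ w ∈ weilClassesOf B' ψ 3 d ∧
            w' = complexBetti.map g (2 * 3) w}) := by
  haveI : HodgeTensorFacts.{0, 0} := hodgeTensorFacts_holds
  exact census_row13_kWeil_of_isIsogenous A φ d hW hS (not_isOfCMType_of_isSimple_of_finrank_endAlgebra_lt hS (by rw [hW.dim_eq]; norm_num)
      (by rw [hE, hW.dim_eq]; omega))
    φE φEdag hgen hdiag hQ hK hRos hφQ hι hE μ hinj hdist hmult k₀ hk₀ hunb k₁ k₂ hk₁₂ hk₁ hk₂ hKW hKE hKE' hA'A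

end Summit.HodgeConjecture.HodgeConjecture.TableX.WeilLieRows
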